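import Literature.NumberTheory.EllipticCurves.HeegnerGeomLayerDescentProofs
import Literature.NumberTheory.EllipticCurves.IwasawaSelmerControlKernelProofs
import HarnessLib

/-!
# The point identities between Howard's norms `z_k` and CGLS's shifted norms `u_k`, `v_k` on a coherent
# system — with LUCAS coefficients, valid for ANY admissible shifts (CGLS 2022 Thm. 4.1.1 / Rem. 4.1.4;
# Howard 2004 §3.3; Perrin-Riou 1987 §3.3) — THEOREMS ONLY

Topic `NumberTheory/EllipticCurves` (complex multiplication / Heegner points); namespace
`Literature.NumberTheory.EllipticCurves`. No definition, no named fact, no `sorry`. Cell `pub/bsd-print-x9`,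
seat `bsd-line-x9-p1-w2` (stub worker; geometric input of the Heegner-module envelope of the crux
`PrintX9.HowardContainmentLightFramePinnedOfPrint[Sharp]`, stub `stub_envelopeModulesTied` / x9-p2's consumer
over the point identities (P1)–(P3)). Sequel of `HeegnerGeomLayerDescentProofs` (layer descent, iterated
recurrence with a Lucas pair `A₀ = 1, A₁ = a_p, B₀ = 0, B₁ = −1, X_{n+2} = a_p X_{n+1} − p X_n`).

For a system `x_j ∈ E(K̄)` over `φ(x(p^j))` (models `P_j ∈ E(K[p^j])`, `x_j` fixed by `Gal(K̄/K[p^j])`), a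
`ℤ_p`-extension `κ` with topological generator `γ`, shifts `d₁ = d(k+1) ≥ 2`, `d₀ = d(k) ≥ 1` with
`K_{k+1} ⊆ K[p^{d₁}]`, `K_{k+1} ⊄ K[p^{d₁−1}]`, `K_k ⊆ K[p^{d₀}]`, `d₀ ≤ d₁ − 1` (which HOLDS for the minimal
shifts, `ringClassSubgroup_pred_le_layerSubgroup`; NO exact formula `d(k) = k − δ + 1` is used), and the
transversals `A_{k+1}`, `A_k`, `R_k` through which `u`, `v`, `z` are sums (the letter of the `∃`-outputs of
`exists_stabilizedHeegnerData_of_system` / `exists_heegnerFamily_of_system`):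
* §1 `transversal_pow_layerSubgroup_succ` — `{γ^{p^k i}}_{i<p}` is a transversal of `Gal(K̄/K_{k+1})` in
  `Gal(K̄/K_k)`; `smul_sum_transversal_smul_eq` — transversal sums are invariant under the ambient group.
* §2 (P3) `sum_transversal_smul_eq_lucas_of_layer` — `z_k = A_e • u_k + B_e • v_k`, `e = k + 1 − d(k)`.
* §3 (P1′) `sum_transversal_smul_pred_eq_lucas_of_layer_succ` — `v_{k+1} = A_n • u_k + B_n • v_k`,
  `n = d₁ − 1 − d₀` (`= 0`, i.e. `v_{k+1} = u_k`, at the minimal shifts off the torsion depth);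
  (P1″) `smul_sum_transversal_smul_pred_eq_of_layer_succ` — `v_{k+1}` is FIXED by `Gal(K̄/K_k)` (at `k = δ`: the
  bottom term of the reverse triangular solve is `K_δ`-rational, killed by `γ^{p^δ} − 1`).
* §4 (P2′) `sum_range_pow_smul_sum_transversal_smul_eq_lucas` — `Σ_{i<p} γ^{p^k i} • u_{k+1} = A_{n+1} • u_k +
  B_{n+1} • v_k` (the norm `N_{K_{k+1}/K_k} u_{k+1}`; `= a_p u_k − v_k` at `n = 0`).
* §5 (appended) `lucas_succ_sub_mul_eq_pow` / `lucas_succ_sub_mul_eq_neg_pow` (+ `int_` casts):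
  `A_{n+1} − βA_n = α^{n+1}`, `B_{n+1} − βB_n = −α^n` whenever `α + β = a_p`, `αβ = p`; and the `n = 0` letters
  (P1) `sum_transversal_smul_pred_eq_of_layer_succ_of_shift` (`v_{k+1} = u_k`) and (P2)
  `sum_range_pow_smul_sum_transversal_smul_eq_frobeniusTrace_smul_sub` (`N u_{k+1} = a_p • u_k − v_k`) at
  consecutive shifts `d(k+1) = d(k) + 1` — the exact hypotheses of `HeegnerEnvelopeDescentProofs`.
With `A_{n+1} − (p/α)A_n = α^{n+1}`, `B_{n+1} − (p/α)B_n = −α^n` these give the EXACT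
norm-compatibility `N κ_{k+1} = κ_k` of `κ_k = α^{-d(k)}(u_k − α⁻¹ v_k)` for any admissible shifts, and the
reverse triangular solve `u_k, v_k ∈ A^{-1}·ℤ[G_k]·{z_j}_{δ<j≤k} + (K_δ-rational)` with unit pivots
(`not_dvd_lucas_of_not_dvd`). HONEST FRAMING: Galois bookkeeping plus the cited CM relations; nothing on
`L`-functions, Selmer groups or BSD is asserted; BSD is not proved by any of this.

References: [CastellaGrossiLeeSkinner2022] Thm. 4.1.1 proof, Rem. 4.1.4 (arXiv:2008.02571v2 p. 22);
[Howard2004HeegnerKolyvagin] §3.3; [PerrinRiou1987BSMF] §3.3; [Washington1997] §13.1.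
-/

set_option autoImplicit false

noncomputable section

open scoped Classical

namespace Literature.NumberTheory.EllipticCurves

open WeierstrassCurve RingClassField

variable {K : Type} [Field K] [NumberField K]

/-! ## §1 The `γ`-power transversal of consecutive layers; invariance of transversal sums -/

omit [NumberField K] in
/-- **`{γ^{p^k i}}_{i<p}` is a transversal of `Gal(K̄/K_{k+1})` in `Gal(K̄/K_k)`** for a topological generator
`γ` (`Gal(K_{k+1}/K_k) = ⟨γ^{p^k}⟩ ≅ ℤ/p`). [cite: Washington1997, §13.1 (Gal(K_{n+1}/K_n) ≅ ℤ/pℤ generated by γ^{p^n})] -/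
theorem transversal_pow_layerSubgroup_succ {p : ℕ} [Fact p.Prime] (κ : ZpExtension K p)
    {γ : Field.absoluteGaloisGroup K} (hγ : κ.IsTopGenerator γ) (k : ℕ) :
    (∀ g ∈ (Finset.range p).image (fun i : ℕ ↦ γ ^ (p ^ k * i)), g ∈ κ.layerSubgroup k) ∧
      ∀ τ ∈ κ.layerSubgroup k, ∃! g, g ∈ (Finset.range p).image (fun i : ℕ ↦ γ ^ (p ^ k * i)) ∧
        g⁻¹ * τ ∈ κ.layerSubgroup (k + 1) := by
  have hp : p.Prime := Fact.out
  have hγ' : κ γ = Multiplicative.ofAdd 1 := hγ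
  have hκγ : ∀ m : ℕ, (κ (γ ^ m)).toAdd = (m : ℤ_[p]) := fun m ↦ by
    rw [map_pow, hγ', ← ofAdd_nsmul, toAdd_ofAdd, nsmul_eq_mul, mul_one]
  have hmem : ∀ i : ℕ, γ ^ (p ^ k * i) ∈ κ.layerSubgroup k := fun i ↦ by
    rw [pow_mul]; exact Subgroup.pow_mem _ (κ.pow_mem_layerSubgroup hγ k) i
  refine ⟨fun g hg ↦ ?_, fun τ hτ ↦ ?_⟩
  · obtain ⟨i, -, rfl⟩ := Finset.mem_image.mp hg
    exact hmem i
  rw [ZpExtension.mem_layerSubgroup] at hτ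
  obtain ⟨c, hc⟩ := hτ
  -- the value of `κ` on `(γ^{p^k j})⁻¹ τ`
  have hval : ∀ j : ℕ, (κ ((γ ^ (p ^ k * j))⁻¹ * τ)).toAdd = (p : ℤ_[p]) ^ k * (c - (j : ℤ_[p])) := by
    intro j
    rw [map_mul, map_inv, toAdd_mul, toAdd_inv, hκγ, hc, Nat.cast_mul, Nat.cast_pow]
    ring
  -- membership criterion
  have hcrit : ∀ j : ℕ, (γ ^ (p ^ k * j))⁻¹ * τ ∈ κ.layerSubgroup (k + 1) ↔
      c - (j : ℤ_[p]) ∈ Ideal.span {(p : ℤ_[p]) ^ 1} := by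
    intro j
    rw [ZpExtension.mem_layerSubgroup, hval, pow_one, Ideal.mem_span_singleton, pow_succ]
    exact mul_dvd_mul_iff_left (pow_ne_zero _ (Nat.cast_ne_zero.mpr hp.ne_zero))
  set i₀ : ℕ := c.appr 1 with hi₀
  have hi₀p : i₀ < p := by simpa using PadicInt.appr_lt c 1
  have hi₀mem : c - (i₀ : ℤ_[p]) ∈ Ideal.span {(p : ℤ_[p]) ^ 1} := PadicInt.appr_spec 1 c
  refine ⟨γ ^ (p ^ k * i₀), ⟨Finset.mem_image.mpr ⟨i₀, Finset.mem_range.mpr hi₀p, rfl⟩,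
    (hcrit i₀).mpr hi₀mem⟩, fun g hg ↦ ?_⟩
  obtain ⟨hgim, hgτ⟩ := hg
  obtain ⟨j, hj, rfl⟩ := Finset.mem_image.mp hgim
  have hjmem := (hcrit j).mp hgτ
  have hzmod := PadicInt.zmod_congr_of_sub_mem_span 1 c j i₀ hjmem hi₀mem
  rw [pow_one, ZMod.natCast_eq_natCast_iff', Nat.mod_eq_of_lt (Finset.mem_range.mp hj),
    Nat.mod_eq_of_lt hi₀p] at hzmod
  rw [hzmod]

section Invariance

variable {Γ : Type*} [Group Γ] {M : Type*} [AddCommMonoid M] [DistribMulAction Γ M]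

/-- **Transversal sums are invariant under the ambient group**: for a transversal `R ⊆ L` of `H` in `L`,
`x` fixed by `H` and `τ ∈ L`, `τ • ∑_{r ∈ R} r • x = ∑_{r ∈ R} r • x` (`τR` is again a transversal; the sum
does not depend on the transversal). [cite: Howard2004HeegnerKolyvagin, §3.3 (Norm_{K_k[1]/K_k} P_k[1] ∈ E(K_k))] -/
theorem smul_sum_transversal_smul_eq {L H : Subgroup Γ} {R : Finset Γ} (hR : ∀ r ∈ R, r ∈ L)
    (htR : ∀ τ ∈ L, ∃! r, r ∈ R ∧ r⁻¹ * τ ∈ H) {x : M} (hx : ∀ σ ∈ H, σ • x = x) {τ : Γ} (hτ : τ ∈ L) :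
    τ • ∑ r ∈ R, r • x = ∑ r ∈ R, r • x := by
  have hinj : Set.InjOn (fun r ↦ τ * r) ↑R := fun a _ b _ h ↦ mul_left_cancel h
  rw [Finset.smul_sum, Finset.sum_congr rfl fun r _ ↦ (mul_smul τ r x).symm,
    ← Finset.sum_image (f := fun r ↦ r • x) hinj]
  refine sum_smul_eq_of_transversal (fun r hr ↦ ?_) hR (fun σ hσ ↦ ?_) htR hx
  · obtain ⟨r₀, hr₀, rfl⟩ := Finset.mem_image.mp hr
    exact L.mul_mem hτ (hR r₀ hr₀)
  · obtain ⟨r₀, ⟨hr₀R, hr₀⟩, huniq⟩ := htR (τ⁻¹ * σ) (L.mul_mem (L.inv_mem hτ) hσ)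
    refine ⟨τ * r₀, ⟨Finset.mem_image.mpr ⟨r₀, hr₀R, rfl⟩, by rwa [mul_inv_rev, mul_assoc]⟩,
      fun r' hr' ↦ ?_⟩
    obtain ⟨hr'im, hr'σ⟩ := hr'
    obtain ⟨r₁, hr₁, rfl⟩ := Finset.mem_image.mp hr'im
    rw [mul_inv_rev, mul_assoc] at hr'σ
    rw [huniq r₁ ⟨hr₁, hr'σ⟩]

end Invariance

/-! ## §2–§4 The identities on a system of principal points -/

section Identities

variable {W : WeierstrassCurve ℚ} [W.IsElliptic] [W.IsGloballyMinimal] [NeZero (W.conductorNorm ℤ)]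
  (hK : IsImaginaryQuadratic K) (hH : SatisfiesHeegnerHypothesis (W.conductorNorm ℤ) K)
  (Dt : ModularForms.ModularParametrizationData W (W.conductorNorm ℤ)) {β : ℤ}
  (hβ : (4 * (W.conductorNorm ℤ : ℕ) : ℤ) ∣ β ^ 2 - NumberField.discr K)
  (jbar : AlgebraicClosure K →+* ℂ) {p : ℕ} [Fact p.Prime] (hpN : ¬ p ∣ W.conductorNorm ℤ)
  {x : ℕ → WeierstrassCurve.geomPoints (W.baseChange K)}
  {P : ∀ j : ℕ,
    (W.baseChange (ringClassField K (jbar.comp (algebraMap K (AlgebraicClosure K))) (p ^ j))).toAffine.Point}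
  (hx : ∀ j, complexPoint W jbar (x j) =
    ModularForms.heegnerPointComplexOfConductor Dt (NumberField.discr K) β (p ^ j))
  (hP : ∀ j, WeierstrassCurve.Affine.Point.map (W' := W)
    (ringClassField K (jbar.comp (algebraMap K (AlgebraicClosure K))) (p ^ j)).subtype.toRatAlgHom (P j) =
    ModularForms.heegnerPointComplexOfConductor Dt (NumberField.discr K) β (p ^ j))
  (hfix : ∀ j, ∀ σ ∈ ringClassSubgroup K (p ^ j) jbar, σ • x j = x j)
  (κ : ZpExtension K p)
  (A B : ℕ → ℤ) (hA0 : A 0 = 1) (hA1 : A 1 = W.frobeniusTrace p)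
  (hA : ∀ n, A (n + 2) = W.frobeniusTrace p * A (n + 1) - p * A n)
  (hB0 : B 0 = 0) (hB1 : B 1 = -1) (hB : ∀ n, B (n + 2) = W.frobeniusTrace p * B (n + 1) - p * B n)

include hK hH hβ hpN hx hP hfix hA0 hA1 hA hB0 hB1 hB

/-- **(P3) Howard's norm through the shifted norms: `z_k = A_e • u_k + B_e • v_k`, `e = k + 1 − d(k)`.**
For a layer `k` with `K_k ⊆ K[p^d]`, `1 ≤ d ≤ k + 1`, a transversal `Aₖ` of `Gal(K̄/K[p^d])` in `Gal(K̄/K_k)`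
(`u_k = ∑_{Aₖ} a • x_d`, `v_k = ∑_{Aₖ} a • x_{d−1}`) and a transversal `R` of `Gal(K̄/K[p^{k+1}])` in
`Gal(K̄/K_k)` (`z_k = ∑_R r • x_{k+1}`). (The iterated recurrence in `Λ = Gal(K̄/K_k)`.)
[cite: CastellaGrossiLeeSkinner2022, Rem. 4.1.4] [cite: Howard2004HeegnerKolyvagin, §3.3] [cite: PerrinRiou1987BSMF, §3.3] -/
theorem sum_transversal_smul_eq_lucas_of_layer {k d : ℕ} (hd : 1 ≤ d) (hdk : d ≤ k + 1)
    (hle : ringClassSubgroup K (p ^ d) jbar ≤ κ.layerSubgroup k)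
    {Aₖ : Finset (Field.absoluteGaloisGroup K)} (hAₖ : ∀ a ∈ Aₖ, a ∈ κ.layerSubgroup k)
    (htAₖ : ∀ τ ∈ κ.layerSubgroup k, ∃! a, a ∈ Aₖ ∧ a⁻¹ * τ ∈ ringClassSubgroup K (p ^ d) jbar)
    {R : Finset (Field.absoluteGaloisGroup K)} (hR : ∀ r ∈ R, r ∈ κ.layerSubgroup k)
    (htR : ∀ τ ∈ κ.layerSubgroup k, ∃! r, r ∈ R ∧ r⁻¹ * τ ∈ ringClassSubgroup K (p ^ (k + 1)) jbar) :
    ∑ r ∈ R, r • x (k + 1) =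
      A (k + 1 - d) • ∑ a ∈ Aₖ, a • x d + B (k + 1 - d) • ∑ a ∈ Aₖ, a • x (d - 1) := by
  obtain ⟨e, rfl⟩ : ∃ e, d = e + 1 := ⟨d - 1, by omega⟩
  obtain ⟨n, hn⟩ : ∃ n, k + 1 = e + 1 + n := ⟨k + 1 - (e + 1), by omega⟩
  rw [hn] at htR ⊢
  rw [Nat.add_sub_cancel_left, Nat.add_sub_cancel]
  exact sum_transversal_smul_eq_lucas_smul_add hK hH Dt hβ jbar (Fact.out) hpN hx hP hfix hle hAₖ htAₖ
    A B hA0 hA1 hA hB0 hB1 hB n hR htR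

/-- **(P1′) The conductor-`p^{d(k+1)−1}` norm of the layer `k + 1` through the shifted norms of the layer `k`:
`v_{k+1} = A_n • u_k + B_n • v_k`, `n = d(k+1) − 1 − d(k)`** (`= u_k` when `n = 0`). Here `d₁ = d(k+1) ≥ 2` with
`K_{k+1} ⊆ K[p^{d₁}]`, `K_{k+1} ⊄ K[p^{d₁−1}]`, `A₁` the transversal of `Gal(K̄/K[p^{d₁}])` in `Gal(K̄/K_{k+1})`
(`v_{k+1} = ∑_{A₁} a • x_{d₁−1}`), and `d₀ = d(k)` with `1 ≤ d₀ ≤ d₁ − 1`, `K_k ⊆ K[p^{d₀}]`, `A₀` the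
transversal of `Gal(K̄/K[p^{d₀}])` in `Gal(K̄/K_k)`. (`A₁` is a transversal of `Gal(K̄/K[p^{d₁−1}])` in
`Gal(K̄/K_k)`, `transversal_ringClassSubgroup_pred_layerSubgroup`; then the iterated recurrence in `Gal(K̄/K_k)`.)
[cite: CastellaGrossiLeeSkinner2022, Thm. 4.1.1 proof (P_k[n]) and Rem. 4.1.4 (P[p^{d(k)-1}])] [cite: Howard2004HeegnerKolyvagin, §3.3] -/
theorem sum_transversal_smul_pred_eq_lucas_of_layer_succ {k d₁ d₀ : ℕ} (hd₁ : 2 ≤ d₁)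
    (hle₁ : ringClassSubgroup K (p ^ d₁) jbar ≤ κ.layerSubgroup (k + 1))
    (hnot₁ : ¬ ringClassSubgroup K (p ^ (d₁ - 1)) jbar ≤ κ.layerSubgroup (k + 1))
    {A₁ : Finset (Field.absoluteGaloisGroup K)} (hA₁ : ∀ a ∈ A₁, a ∈ κ.layerSubgroup (k + 1))
    (htA₁ : ∀ τ ∈ κ.layerSubgroup (k + 1), ∃! a, a ∈ A₁ ∧ a⁻¹ * τ ∈ ringClassSubgroup K (p ^ d₁) jbar)
    (hd₀ : 1 ≤ d₀) (hd₀₁ : d₀ ≤ d₁ - 1) (hle₀ : ringClassSubgroup K (p ^ d₀) jbar ≤ κ.layerSubgroup k)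
    {A₀ : Finset (Field.absoluteGaloisGroup K)} (hA₀ : ∀ a ∈ A₀, a ∈ κ.layerSubgroup k)
    (htA₀ : ∀ τ ∈ κ.layerSubgroup k, ∃! a, a ∈ A₀ ∧ a⁻¹ * τ ∈ ringClassSubgroup K (p ^ d₀) jbar) :
    ∑ a ∈ A₁, a • x (d₁ - 1) =
      A (d₁ - 1 - d₀) • ∑ a ∈ A₀, a • x d₀ + B (d₁ - 1 - d₀) • ∑ a ∈ A₀, a • x (d₀ - 1) := by
  obtain ⟨hA₁', htA₁'⟩ := transversal_ringClassSubgroup_pred_layerSubgroup hK jbar κ hd₁ hle₁ hnot₁ hA₁ htA₁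
  obtain ⟨e, rfl⟩ : ∃ e, d₀ = e + 1 := ⟨d₀ - 1, by omega⟩
  obtain ⟨n, hn⟩ : ∃ n, d₁ - 1 = e + 1 + n := ⟨d₁ - 1 - (e + 1), by omega⟩
  rw [hn] at htA₁' ⊢
  rw [Nat.add_sub_cancel_left, Nat.add_sub_cancel]
  exact sum_transversal_smul_eq_lucas_smul_add hK hH Dt hβ jbar (Fact.out) hpN hx hP hfix hle₀ hA₀ htA₀
    A B hA0 hA1 hA hB0 hB1 hB n hA₁' htA₁'

omit [W.IsElliptic] [W.IsGloballyMinimal] [NeZero (W.conductorNorm ℤ)] hH hβ hpN hx hP hA0 hA1 hA hB0 hB1 hB in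
/-- **(P1″) `v_{k+1}` is `K_k`-rational**: with `d₁`, `A₁` as in (P1′), `τ • ∑_{A₁} a • x_{d₁−1} = ∑_{A₁} a • x_{d₁−1}`
for every `τ ∈ Gal(K̄/K_k)` — at `k = δ` this is the `K_δ`-rational bottom term of the reverse triangular
solve, killed by `γ^{p^δ} − 1`. [cite: CastellaGrossiLeeSkinner2022, Rem. 4.1.4 (P[p^{d(k)-1}] ∈ E(K[p^{d(k)-1}]))] [cite: Howard2004HeegnerKolyvagin, §3.3] -/
theorem smul_sum_transversal_smul_pred_eq_of_layer_succ {k d₁ : ℕ} (hd₁ : 2 ≤ d₁)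
    (hle₁ : ringClassSubgroup K (p ^ d₁) jbar ≤ κ.layerSubgroup (k + 1))
    (hnot₁ : ¬ ringClassSubgroup K (p ^ (d₁ - 1)) jbar ≤ κ.layerSubgroup (k + 1))
    {A₁ : Finset (Field.absoluteGaloisGroup K)} (hA₁ : ∀ a ∈ A₁, a ∈ κ.layerSubgroup (k + 1))
    (htA₁ : ∀ τ ∈ κ.layerSubgroup (k + 1), ∃! a, a ∈ A₁ ∧ a⁻¹ * τ ∈ ringClassSubgroup K (p ^ d₁) jbar)
    {τ : Field.absoluteGaloisGroup K} (hτ : τ ∈ κ.layerSubgroup k) :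
    τ • ∑ a ∈ A₁, a • x (d₁ - 1) = ∑ a ∈ A₁, a • x (d₁ - 1) := by
  obtain ⟨hA₁', htA₁'⟩ := transversal_ringClassSubgroup_pred_layerSubgroup hK jbar κ hd₁ hle₁ hnot₁ hA₁ htA₁
  exact smul_sum_transversal_smul_eq hA₁' htA₁' (hfix (d₁ - 1)) hτ

/-- **(P2′) The norm of `u_{k+1}` to the layer below: `∑_{i<p} γ^{p^k i} • u_{k+1} = A_{n+1} • u_k + B_{n+1} • v_k`,
`n = d(k+1) − 1 − d(k)`** (`= a_p • u_k − v_k` when `n = 0`); data as in (P1′), `γ` a topological generator.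
(`{γ^{p^k i}}` is a transversal of `Gal(K̄/K_{k+1})` in `Gal(K̄/K_k)`, so the double sum is ONE transversal sum
of `x_{d₁}` over `Gal(K̄/K_k)/Gal(K̄/K[p^{d₁}])` (`sum_smul_eq_sum_sum_smul`); then the iterated recurrence.)
[cite: CastellaGrossiLeeSkinner2022, Rem. 4.1.4 ("the points α^{-k}P[p^k]_α are norm-compatible")] [cite: PerrinRiou1987BSMF, §3.3] -/
theorem sum_range_pow_smul_sum_transversal_smul_eq_lucas {γ : Field.absoluteGaloisGroup K}
    (hγ : κ.IsTopGenerator γ) {k d₁ d₀ : ℕ} (hd₁ : 2 ≤ d₁)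
    (hle₁ : ringClassSubgroup K (p ^ d₁) jbar ≤ κ.layerSubgroup (k + 1))
    {A₁ : Finset (Field.absoluteGaloisGroup K)} (hA₁ : ∀ a ∈ A₁, a ∈ κ.layerSubgroup (k + 1))
    (htA₁ : ∀ τ ∈ κ.layerSubgroup (k + 1), ∃! a, a ∈ A₁ ∧ a⁻¹ * τ ∈ ringClassSubgroup K (p ^ d₁) jbar)
    (hd₀ : 1 ≤ d₀) (hd₀₁ : d₀ ≤ d₁ - 1) (hle₀ : ringClassSubgroup K (p ^ d₀) jbar ≤ κ.layerSubgroup k)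
    {A₀ : Finset (Field.absoluteGaloisGroup K)} (hA₀ : ∀ a ∈ A₀, a ∈ κ.layerSubgroup k)
    (htA₀ : ∀ τ ∈ κ.layerSubgroup k, ∃! a, a ∈ A₀ ∧ a⁻¹ * τ ∈ ringClassSubgroup K (p ^ d₀) jbar) :
    ∑ i ∈ Finset.range p, γ ^ (p ^ k * i) • ∑ a ∈ A₁, a • x d₁ =
      A (d₁ - d₀) • ∑ a ∈ A₀, a • x d₀ + B (d₁ - d₀) • ∑ a ∈ A₀, a • x (d₀ - 1) := by
  have hp : p.Prime := Fact.out
  -- `i ↦ γ^{p^k i}` is injective (`κ(γ^m) = m`)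
  have hγ' : κ γ = Multiplicative.ofAdd 1 := hγ
  have hinj : Set.InjOn (fun i : ℕ ↦ γ ^ (p ^ k * i)) ↑(Finset.range p) := by
    intro i _ j _ h
    have h' := congrArg (fun g ↦ (κ g).toAdd) h
    simp only [map_pow, hγ', ← ofAdd_nsmul, toAdd_ofAdd, nsmul_eq_mul, mul_one, Nat.cast_mul,
      Nat.cast_pow] at h'
    exact_mod_cast mul_left_cancel₀ (pow_ne_zero k (Nat.cast_ne_zero.mpr hp.ne_zero)) h'
  rw [← Finset.sum_image (f := fun g ↦ g • ∑ a ∈ A₁, a • x d₁) hinj]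
  obtain ⟨hG, htG⟩ := transversal_pow_layerSubgroup_succ κ hγ k
  -- one transversal sum over `Gal(K̄/K_k)/Gal(K̄/K[p^{d₁}])`
  have hle₁' : ringClassSubgroup K (p ^ d₁) jbar ≤ κ.layerSubgroup k :=
    hle₁.trans (κ.layerSubgroup_antitone (Nat.le_succ k))
  haveI := finiteIndex_ringClassSubgroup K (p ^ d₁) jbar
  obtain ⟨R, hR, htR⟩ := exists_finset_transversal' (ringClassSubgroup K (p ^ d₁) jbar) (κ.layerSubgroup k)
  rw [← sum_smul_eq_sum_sum_smul hle₁ (κ.layerSubgroup_antitone (Nat.le_succ k)) hG htG hA₁ htA₁ hR htR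
    (hfix d₁)]
  -- the iterated recurrence in `Gal(K̄/K_k)` from level `d₀` up to `d₁ = d₀ + (n+1)`
  obtain ⟨e, rfl⟩ : ∃ e, d₀ = e + 1 := ⟨d₀ - 1, by omega⟩
  obtain ⟨n, hn⟩ : ∃ n, d₁ = e + 1 + n := ⟨d₁ - (e + 1), by omega⟩
  subst hn
  rw [Nat.add_sub_cancel_left, Nat.add_sub_cancel]
  exact sum_transversal_smul_eq_lucas_smul_add hK hH Dt hβ jbar hp hpN hx hP hfix hle₀ hA₀ htA₀
    A B hA0 hA1 hA hB0 hB1 hB n hR htR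

end Identities

/-! ## §5 Lucas pairs: existence, the unit-root identities, and the `n = 0` letters (P1), (P2)
(appended 2026-08-28 by the same seat; §§1–4 above unchanged) -/

section Lucas

/-- **Integer solutions of the two-term recurrence exist with any initial values** (`X₀, X₁` given,
`X_{n+2} = a X_{n+1} − q X_n`; the pair-valued recursion `(X_n, X_{n+1})`); private plumbing for the `n = 0`
letters below. [folklore] -/
private theorem exists_lucas_seq (a q x₀ x₁ : ℤ) :
    ∃ X : ℕ → ℤ, X 0 = x₀ ∧ X 1 = x₁ ∧ ∀ n, X (n + 2) = a * X (n + 1) - q * X n := by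
  let F : ℕ → ℤ × ℤ := fun n ↦ Nat.rec (x₀, x₁) (fun _ y ↦ (y.2, a * y.2 - q * y.1)) n
  have hF : ∀ n, F (n + 1) = ((F n).2, a * (F n).2 - q * (F n).1) := fun n ↦ rfl
  refine ⟨fun n ↦ (F n).1, rfl, ?_, fun n ↦ ?_⟩
  · show (F (0 + 1)).1 = x₁
    rw [hF 0]
    rfl
  · show (F (n + 1 + 1)).1 = a * (F (n + 1)).1 - q * (F n).1
    rw [hF (n + 1), hF n]

/-- **`A_{n+1} − β A_n = α^{n+1}`** for a Lucas sequence `A₀ = 1, A₁ = a, A_{n+2} = a A_{n+1} − q A_n` in a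
commutative ring with `α + β = a`, `αβ = q` (for Heegner norms: `α` the unit root, `β = p/α`; this is the
EXACT norm-compatibility `N κ_{k+1} = κ_k` of CGLS's `κ_k = α^{-d(k)}(u_k − α⁻¹ v_k)` for ANY admissible shifts).
[cite: CastellaGrossiLeeSkinner2022, Rem. 4.1.4 ("a straightforward calculation shows that the points α^{-k}P[p^k]_α are norm-compatible")]
[cite: PerrinRiou1987BSMF, §3.3 Lemme 1–Prop. 3] -/
theorem lucas_succ_sub_mul_eq_pow {S : Type*} [CommRing S] {a q α β : S} (hab : α + β = a)
    (hαβ : α * β = q) (A : ℕ → S) (hA0 : A 0 = 1) (hA1 : A 1 = a)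
    (hA : ∀ n, A (n + 2) = a * A (n + 1) - q * A n) (n : ℕ) :
    A (n + 1) - β * A n = α ^ (n + 1) := by
  induction n with
  | zero => rw [hA1, hA0, mul_one, zero_add, pow_one, ← hab, add_sub_cancel_right]
  | succ n ih =>
    rw [hA n, pow_succ, ← ih, ← hab, ← hαβ]
    ring

/-- **`B_{n+1} − β B_n = −α^n`** for the companion sequence `B₀ = 0, B₁ = −1`, same recurrence.
[cite: CastellaGrossiLeeSkinner2022, Rem. 4.1.4] [cite: PerrinRiou1987BSMF, §3.3] -/
theorem lucas_succ_sub_mul_eq_neg_pow {S : Type*} [CommRing S] {a q α β : S} (hab : α + β = a)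
    (hαβ : α * β = q) (B : ℕ → S) (hB0 : B 0 = 0) (hB1 : B 1 = -1)
    (hB : ∀ n, B (n + 2) = a * B (n + 1) - q * B n) (n : ℕ) :
    B (n + 1) - β * B n = -α ^ n := by
  induction n with
  | zero => rw [hB1, hB0, mul_zero, sub_zero, pow_zero]
  | succ n ih =>
    rw [hB n, pow_succ, show -(α ^ n * α) = (-α ^ n) * α by ring, ← ih, ← hab, ← hαβ]
    ring

/-- The integer Lucas sequence `A` (`A₀ = 1`, `A₁ = a`) read in a ring containing the roots:
`A_{n+1} − β A_n = α^{n+1}`. [cite: CastellaGrossiLeeSkinner2022, Rem. 4.1.4] -/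
theorem int_lucas_succ_sub_mul_eq_pow {S : Type*} [CommRing S] {a : ℤ} {q : ℕ} {α β : S}
    (hab : α + β = a) (hαβ : α * β = q) (A : ℕ → ℤ) (hA0 : A 0 = 1) (hA1 : A 1 = a)
    (hA : ∀ n, A (n + 2) = a * A (n + 1) - q * A n) (n : ℕ) :
    (A (n + 1) : S) - β * (A n : S) = α ^ (n + 1) := by
  refine lucas_succ_sub_mul_eq_pow hab hαβ (fun n ↦ (A n : S)) (by simp [hA0]) (by simp [hA1]) ?_ n
  intro m; simp only [hA m]; push_cast; ring

/-- The integer companion sequence `B` (`B₀ = 0`, `B₁ = −1`) read in a ring containing the roots: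
`B_{n+1} − β B_n = −α^n`. [cite: CastellaGrossiLeeSkinner2022, Rem. 4.1.4] -/
theorem int_lucas_succ_sub_mul_eq_neg_pow {S : Type*} [CommRing S] {a : ℤ} {q : ℕ} {α β : S}
    (hab : α + β = a) (hαβ : α * β = q) (B : ℕ → ℤ) (hB0 : B 0 = 0) (hB1 : B 1 = -1)
    (hB : ∀ n, B (n + 2) = a * B (n + 1) - q * B n) (n : ℕ) :
    (B (n + 1) : S) - β * (B n : S) = -α ^ n := by
  refine lucas_succ_sub_mul_eq_neg_pow hab hαβ (fun n ↦ (B n : S)) (by simp [hB0]) (by simp [hB1]) ?_ n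
  intro m; simp only [hB m]; push_cast; ring

end Lucas

section MinimalShift

variable {W : WeierstrassCurve ℚ} [W.IsElliptic] [W.IsGloballyMinimal] [NeZero (W.conductorNorm ℤ)]
  (hK : IsImaginaryQuadratic K) (hH : SatisfiesHeegnerHypothesis (W.conductorNorm ℤ) K)
  (Dt : ModularForms.ModularParametrizationData W (W.conductorNorm ℤ)) {β : ℤ}
  (hβ : (4 * (W.conductorNorm ℤ : ℕ) : ℤ) ∣ β ^ 2 - NumberField.discr K)
  (jbar : AlgebraicClosure K →+* ℂ) {p : ℕ} [Fact p.Prime] (hpN : ¬ p ∣ W.conductorNorm ℤ)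
  {x : ℕ → WeierstrassCurve.geomPoints (W.baseChange K)}
  {P : ∀ j : ℕ,
    (W.baseChange (ringClassField K (jbar.comp (algebraMap K (AlgebraicClosure K))) (p ^ j))).toAffine.Point}
  (hx : ∀ j, complexPoint W jbar (x j) =
    ModularForms.heegnerPointComplexOfConductor Dt (NumberField.discr K) β (p ^ j))
  (hP : ∀ j, WeierstrassCurve.Affine.Point.map (W' := W)
    (ringClassField K (jbar.comp (algebraMap K (AlgebraicClosure K))) (p ^ j)).subtype.toRatAlgHom (P j) =
    ModularForms.heegnerPointComplexOfConductor Dt (NumberField.discr K) β (p ^ j))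
  (hfix : ∀ j, ∀ σ ∈ ringClassSubgroup K (p ^ j) jbar, σ • x j = x j)
  (κ : ZpExtension K p)

include hK hH hβ hpN hx hP hfix

/-- **(P1) at consecutive shifts: `v_{k+1} = u_k`** — the letter the cell's Kummer consumer
(`HeegnerEnvelopeDescentProofs`, (P1)) takes, when `d(k+1) = d(k) + 1` (the minimal shifts off the torsion
depth). [cite: CastellaGrossiLeeSkinner2022, Thm. 4.1.1 proof (P_k[n]) and Rem. 4.1.4] [cite: Howard2004HeegnerKolyvagin, §3.3] -/
theorem sum_transversal_smul_pred_eq_of_layer_succ_of_shift {k d₀ : ℕ} (hd₀ : 1 ≤ d₀)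
    (hle₁ : ringClassSubgroup K (p ^ (d₀ + 1)) jbar ≤ κ.layerSubgroup (k + 1))
    (hnot₁ : ¬ ringClassSubgroup K (p ^ d₀) jbar ≤ κ.layerSubgroup (k + 1))
    {A₁ : Finset (Field.absoluteGaloisGroup K)} (hA₁ : ∀ a ∈ A₁, a ∈ κ.layerSubgroup (k + 1))
    (htA₁ : ∀ τ ∈ κ.layerSubgroup (k + 1), ∃! a, a ∈ A₁ ∧ a⁻¹ * τ ∈ ringClassSubgroup K (p ^ (d₀ + 1)) jbar)
    (hle₀ : ringClassSubgroup K (p ^ d₀) jbar ≤ κ.layerSubgroup k)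
    {A₀ : Finset (Field.absoluteGaloisGroup K)} (hA₀ : ∀ a ∈ A₀, a ∈ κ.layerSubgroup k)
    (htA₀ : ∀ τ ∈ κ.layerSubgroup k, ∃! a, a ∈ A₀ ∧ a⁻¹ * τ ∈ ringClassSubgroup K (p ^ d₀) jbar) :
    ∑ a ∈ A₁, a • x d₀ = ∑ a ∈ A₀, a • x d₀ := by
  obtain ⟨A, hA0, hA1, hA⟩ := exists_lucas_seq (W.frobeniusTrace p) p 1 (W.frobeniusTrace p)
  obtain ⟨B, hB0, hB1, hB⟩ := exists_lucas_seq (W.frobeniusTrace p) p 0 (-1)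
  have h := sum_transversal_smul_pred_eq_lucas_of_layer_succ hK hH Dt hβ jbar hpN hx hP hfix κ A B hA0 hA1
    hA hB0 hB1 hB (k := k) (d₁ := d₀ + 1) (d₀ := d₀) (by omega) hle₁ (by rwa [Nat.add_sub_cancel]) hA₁
    htA₁ hd₀ (by omega) hle₀ hA₀ htA₀
  rwa [Nat.add_sub_cancel, Nat.sub_self, hA0, hB0, one_smul, zero_smul, add_zero] at h

/-- **(P2) at consecutive shifts: `Σ_{i<p} γ^{p^k i} • u_{k+1} = a_p • u_k − v_k`** — the vertical distribution
relation `N_{K_{k+1}/K_k} u_{k+1} = a_p u_k − v_k` in the letter of the cell's Kummer consumer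
(`HeegnerEnvelopeDescentProofs`, (P2)), when `d(k+1) = d(k) + 1`.
[cite: CastellaGrossiLeeSkinner2022, Rem. 4.1.4] [cite: PerrinRiou1987BSMF, §3.3 (relations de distribution)]
[cite: Howard2004HeegnerKolyvagin, §3.3] -/
theorem sum_range_pow_smul_sum_transversal_smul_eq_frobeniusTrace_smul_sub
    {γ : Field.absoluteGaloisGroup K} (hγ : κ.IsTopGenerator γ) {k d₀ : ℕ} (hd₀ : 1 ≤ d₀)
    (hle₁ : ringClassSubgroup K (p ^ (d₀ + 1)) jbar ≤ κ.layerSubgroup (k + 1))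
    {A₁ : Finset (Field.absoluteGaloisGroup K)} (hA₁ : ∀ a ∈ A₁, a ∈ κ.layerSubgroup (k + 1))
    (htA₁ : ∀ τ ∈ κ.layerSubgroup (k + 1), ∃! a, a ∈ A₁ ∧ a⁻¹ * τ ∈ ringClassSubgroup K (p ^ (d₀ + 1)) jbar)
    (hle₀ : ringClassSubgroup K (p ^ d₀) jbar ≤ κ.layerSubgroup k)
    {A₀ : Finset (Field.absoluteGaloisGroup K)} (hA₀ : ∀ a ∈ A₀, a ∈ κ.layerSubgroup k)
    (htA₀ : ∀ τ ∈ κ.layerSubgroup k, ∃! a, a ∈ A₀ ∧ a⁻¹ * τ ∈ ringClassSubgroup K (p ^ d₀) jbar) :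
    ∑ i ∈ Finset.range p, γ ^ (p ^ k * i) • ∑ a ∈ A₁, a • x (d₀ + 1) =
      (W.frobeniusTrace p) • ∑ a ∈ A₀, a • x d₀ - ∑ a ∈ A₀, a • x (d₀ - 1) := by
  obtain ⟨A, hA0, hA1, hA⟩ := exists_lucas_seq (W.frobeniusTrace p) p 1 (W.frobeniusTrace p)
  obtain ⟨B, hB0, hB1, hB⟩ := exists_lucas_seq (W.frobeniusTrace p) p 0 (-1)
  have h := sum_range_pow_smul_sum_transversal_smul_eq_lucas hK hH Dt hβ jbar hpN hx hP hfix κ A B hA0 hA1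
    hA hB0 hB1 hB hγ (k := k) (d₁ := d₀ + 1) (d₀ := d₀) (by omega) hle₁ hA₁ htA₁ hd₀ (by omega) hle₀ hA₀
    htA₀
  rwa [Nat.add_sub_cancel_left, hA1, hB1, neg_smul, one_smul, ← sub_eq_add_neg] at h

end MinimalShift

end Literature.NumberTheory.EllipticCurves

end
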